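import Summits.ResolutionOfSingularities.ResolutionOfSingularities.Theorems.FrobeniusLadderFRationalResolutionHypersurfaceLocalRegular
import Literature.AlgebraicGeometry.Resolution.TameQuotientSingularitiesResolutionProofs
import Mathlib.RingTheory.Derivation.MapCoeffs
import Mathlib.RingTheory.GradedAlgebra.Basic
import HarnessLib

/-!
# Crux `FrobeniusLadder.FRationalResolution` (stmt-ResolutionOfSingularities-15317), line `redirect`,
# stub `stub_diagonalizableQuotientResolution` — item (F2b): the root-adjunction chart `S̃ = S[w]/(w^d − u)` is REGULAR at the
# primes over the point as soon as a DERIVATION of `S` does not vanish on `u` there; the Euler derivation of the grading does so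
# whenever `deg u ∉ pA`

The hypothesis `hreg` of `…FixedChartOfRoot.exists_fixed_chart_of_rootAdjoin` asks for the regularity of `AdjoinRoot (X^d − C u)`
at the primes over `v`. By `…HypersurfaceLocalRegular` it suffices that `X^d − C u ∉ (𝔓' S[X]_{𝔓'})²`. A derivation `D` of `S`
extends coefficientwise to `S[X]` with `D X = 0` (Mathlib `Differential.mapCoeffs`), so `D (X^d − C u) = −C (D u)`, while `D` maps
`𝔓'²` into `𝔓'`; hence:

* `not_mem_sq_of_derivation` — if `D u ∉ 𝔓' ∩ S` then `X^d − C u ∉ (𝔓'S[X]_{𝔓'})²` (ANY `d`, any characteristic);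
* `isRegularLocalRing_localization_adjoinRoot_of_derivation` — `S` regular, `D u ∉ 𝔓 ∩ S` ⇒ `(S̃)_𝔓` regular;
* `exists_eulerDerivation` — for an `A`-graded `k`-algebra and an additive `χ : A →+ k`, the EULER DERIVATION `θ_χ(s) = χ(i) s` on
  `S_i`;
* ★★★ `isRegularLocalRing_localization_adjoinRoot_of_addChar` — `S` regular graded by a torsion group, `u ∈ S_b` outside one prime
  over the point `𝔮` of `Spec S₀`, and `χ : A →+ k` with `χ b` a unit (exists iff `b ∉ pA` in characteristic `p`): **`S̃` is regular at
  every prime over `𝔮`** — the hypothesis `hreg`, discharged.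

With `…FixedChartOfRoot`: points whose unit subgroup `B` satisfies `B + ⟨a⟩ = A`, `d • a = b ∈ B ∖ pA` re-chart to FIXED points
unconditionally (e.g. `A = ℤ/p ⊕ ℤ/p³`, `B = ⟨(1,p)⟩`, not a direct summand). What remains of (F2) is the core `B ≤ pA`
(e.g. `pℤ/p² < ℤ/p²`), MEMO-15317-leafhand2-g21 §3. Honest label: helper toward ONE leaf stub; no stub, crux or summit closed. No
definitions, no named facts, no sorry. [cite: Matsumura1987, Thm. 14.2; §25] [folklore; cite: SGA3, Exp. VIII §4–5]
-/

noncomputable section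

-- single-problem summit: the doubled namespace component is forced
set_option linter.dupNamespace false

open IsLocalRing Polynomial DirectSum
open Literature.AlgebraicGeometry.Resolution

namespace Summit.ResolutionOfSingularities.ResolutionOfSingularities.Theorems.FRationalResolution.RootAdjoinRegularOfDerivation

universe u v w

/-! ### A derivation certifies `X^d − u ∉ 𝔓'^{(2)}` -/

/-- **Derivation certificate.** For a derivation `D` of `S`, `u ∈ S`, `d : ℕ` and a prime `𝔓'` of `S[X]` containing `X^d − C u`:
if `D u ∉ 𝔓' ∩ S`, then the image of `X^d − C u` in `S[X]_{𝔓'}` is not in the square of the maximal ideal.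
[cite: Matsumura1987, §25] -/
theorem not_mem_sq_of_derivation {S : Type u} [CommRing S] (D : Derivation ℤ S S) (u : S) (d : ℕ)
    (𝔓' : Ideal S[X]) [h𝔓' : 𝔓'.IsPrime] (hf : (X ^ d - C u : S[X]) ∈ 𝔓') (hDu : D u ∉ 𝔓'.comap C) :
    algebraMap S[X] (Localization.AtPrime 𝔓') (X ^ d - C u) ∉ maximalIdeal (Localization.AtPrime 𝔓') ^ 2 := by
  letI : Differential S := ⟨D⟩
  set f : S[X] := X ^ d - C u with hfdef
  let D' : Derivation ℤ S[X] S[X] := Differential.mapCoeffs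
  -- `D' f = − C (D u)`
  have hD'f : D' f = -C (D u) := by
    have hX : D' (X ^ d) = 0 := by
      rw [Derivation.leibniz_pow, Differential.mapCoeffs_X, smul_zero, smul_zero]
    rw [hfdef, map_sub, hX, Differential.mapCoeffs_C, zero_sub]
    rfl
  -- `D'` maps `𝔓'²` into `𝔓'`
  have hD'sq : ∀ g ∈ 𝔓' ^ 2, D' g ∈ 𝔓' := by
    intro g hg
    rw [pow_two] at hg
    refine Submodule.mul_induction_on hg (fun a ha b hb => ?_) (fun x y hx hy => ?_)
    · rw [Derivation.leibniz, smul_eq_mul, smul_eq_mul]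
      exact 𝔓'.add_mem (𝔓'.mul_mem_right (D' b) ha) (𝔓'.mul_mem_right (D' a) hb)
    · rw [map_add]; exact 𝔓'.add_mem hx hy
  intro hmem
  rw [← Localization.AtPrime.map_eq_maximalIdeal, ← Ideal.map_pow,
    IsLocalization.mem_map_algebraMap_iff 𝔓'.primeCompl] at hmem
  obtain ⟨⟨⟨g, hg⟩, ⟨m, hm⟩⟩, hgm⟩ := hmem
  obtain ⟨⟨c, hc⟩, hcfm⟩ := (IsLocalization.eq_iff_exists 𝔓'.primeCompl _).1
    (show algebraMap S[X] (Localization.AtPrime 𝔓') (f * m) = algebraMap S[X] _ g by rw [map_mul]; exact hgm)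
  simp only at hcfm
  -- `s f ∈ 𝔓'²` with `s = c m ∉ 𝔓'`
  have hs : c * m ∉ 𝔓' := fun h => (h𝔓'.mem_or_mem h).elim hc hm
  have hsf : c * m * f ∈ 𝔓' ^ 2 := by
    rw [mul_assoc, mul_comm m f, hcfm]
    exact Ideal.mul_mem_left _ _ hg
  have h1 : D' (c * m * f) ∈ 𝔓' := hD'sq _ hsf
  rw [Derivation.leibniz, smul_eq_mul, smul_eq_mul] at h1
  have h2 : c * m * D' f ∈ 𝔓' := by
    have h3 : f * D' (c * m) ∈ 𝔓' := 𝔓'.mul_mem_right _ hf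
    have := 𝔓'.sub_mem h1 h3
    rwa [add_sub_cancel_right] at this
  have h4 : D' f ∈ 𝔓' := ((h𝔓'.mem_or_mem h2).resolve_left hs)
  rw [hD'f, neg_mem_iff] at h4
  exact hDu (Ideal.mem_comap.2 h4)

/-- **Regularity of `(AdjoinRoot (X^d − C u))_𝔓` from a derivation**: `S` a regular ring, `D` a derivation of `S` with
`D u ∉ 𝔓 ∩ S`. [cite: Matsumura1987, Thm. 14.2; §25] -/
theorem isRegularLocalRing_localization_adjoinRoot_of_derivation {S : Type u} [CommRing S] [IsRegularRing S]
    (D : Derivation ℤ S S) (u : S) (d : ℕ) (𝔓 : Ideal (AdjoinRoot (X ^ d - C u : S[X]))) [𝔓.IsPrime]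
    (hDu : D u ∉ 𝔓.comap (AdjoinRoot.of (X ^ d - C u : S[X]))) :
    IsRegularLocalRing (Localization.AtPrime 𝔓) := by
  haveI : (𝔓.comap (AdjoinRoot.mk (X ^ d - C u : S[X]))).IsPrime := Ideal.IsPrime.comap _
  refine HypersurfaceLocalRegular.isRegularLocalRing_localization_adjoinRoot_of_not_mem_sq _ 𝔓
    (not_mem_sq_of_derivation D u d _ ?_ ?_)
  · rw [Ideal.mem_comap, AdjoinRoot.mk_self]; exact 𝔓.zero_mem
  · rwa [Ideal.comap_comap]

/-! ### The Euler derivation of a grading -/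

/-- **The Euler derivation** of an `A`-graded `k`-algebra attached to an additive `χ : A →+ k`: a `k`-derivation `θ` with
`θ s = χ i • s` for `s ∈ S_i` (existential package). [folklore; cite: SGA3, Exp. VIII §4–5] -/
theorem exists_eulerDerivation {k : Type u} [CommRing k] {A : Type w} [DecidableEq A] [AddCommMonoid A] {S : Type v}
    [CommRing S] [Algebra k S] (𝒮 : A → Submodule k S) [GradedAlgebra 𝒮] (χ : A →+ k) :
    ∃ θ : Derivation k S S, ∀ (i : A) (s : S), s ∈ 𝒮 i → θ s = χ i • s := by
  classical
  let L : S →ₗ[k] S :=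
    (DirectSum.toModule k A S fun i => χ i • (𝒮 i).subtype) ∘ₗ (decomposeLinearEquiv 𝒮).toLinearMap
  have hL : ∀ (i : A) (s : S), s ∈ 𝒮 i → L s = χ i • s := by
    intro i s hs
    simp only [L, LinearMap.coe_comp, Function.comp_apply, LinearEquiv.coe_toLinearMap, decomposeLinearEquiv_apply,
      decompose_of_mem 𝒮 hs, ← lof_eq_of k, toModule_lof, LinearMap.smul_apply, Submodule.subtype_apply]
  have hone : L 1 = 0 := by rw [hL 0 1 (SetLike.one_mem_graded 𝒮), map_zero, zero_smul]
  have hleib : ∀ a b : S, L (a * b) = a • L b + b • L a := by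
    intro a b
    induction a using DirectSum.Decomposition.inductionOn 𝒮 with
    | zero => simp
    | add a a' ha ha' => simp only [add_mul, map_add, ha, ha', smul_add, add_smul]; abel
    | homogeneous x =>
      induction b using DirectSum.Decomposition.inductionOn 𝒮 with
      | zero => simp
      | add b b' hb hb' => simp only [mul_add, map_add, hb, hb', smul_add, add_smul]; abel
      | homogeneous y =>
        rename_i i j
        rw [hL (i + j) _ (SetLike.mul_mem_graded x.2 y.2), hL j _ y.2, hL i _ x.2, map_add, add_smul, smul_eq_mul,
          smul_eq_mul, Algebra.mul_smul_comm, Algebra.mul_smul_comm, mul_comm (y : S) (x : S), add_comm]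
  exact ⟨{ toLinearMap := L, map_one_eq_zero' := hone, leibniz' := hleib }, hL⟩

/-! ### `hreg` discharged when `deg u` admits an additive character -/

/-- ★★★ **The root-adjunction chart is regular at the primes over the point when `deg u` admits an additive character.**
`S` regular, graded by the torsion group `A` over `k`; `u ∈ S_b` outside a prime `𝔔` of `S` over the point `𝔮` of `Spec S₀`;
`χ : A →+ k` with `χ b` a unit. Then `AdjoinRoot (X^d − C u)` is a regular local ring at EVERY prime `𝔓` over `𝔮` — the hypothesis
`hreg` of `…FixedChartOfRoot.exists_fixed_chart_of_rootAdjoin`. (In characteristic `p` such a `χ` exists iff `b ∉ pA`.)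
[folklore; cite: SGA3, Exp. VIII §4–5] [cite: Matsumura1987, Thm. 14.2; §25] -/
theorem isRegularLocalRing_localization_adjoinRoot_of_addChar {k : Type u} [CommRing k] {A : Type w} [DecidableEq A]
    [AddCommGroup A] {S : Type u} [CommRing S] [Algebra k S] (𝒮 : A → Submodule k S) [GradedAlgebra 𝒮] [IsRegularRing S]
    (hA : AddMonoid.IsTorsion A) {b : A} {u : S} (hu : u ∈ 𝒮 b) (𝔔 : Ideal S) [𝔔.IsPrime] (huQ : u ∉ 𝔔)
    (χ : A →+ k) (hχ : IsUnit (χ b)) (d : ℕ)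
    (𝔓 : Ideal (AdjoinRoot (X ^ d - C u : S[X]))) [𝔓.IsPrime]
    (h𝔓 : 𝔓.comap (algebraMap (𝒮 0) (AdjoinRoot (X ^ d - C u : S[X]))) = 𝔔.comap (algebraMap (𝒮 0) S)) :
    IsRegularLocalRing (Localization.AtPrime 𝔓) := by
  obtain ⟨θ, hθ⟩ := exists_eulerDerivation 𝒮 χ
  refine isRegularLocalRing_localization_adjoinRoot_of_derivation (θ.restrictScalars ℤ) u d 𝔓 ?_
  -- the prime `𝔓 ∩ S` lies over `𝔮`, so `u ∉ 𝔓 ∩ S` (a power of `u` is a degree-zero element outside `𝔮`)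
  set 𝔔₁ : Ideal S := 𝔓.comap (AdjoinRoot.of (X ^ d - C u : S[X])) with h𝔔₁
  haveI : 𝔔₁.IsPrime := Ideal.IsPrime.comap _
  have h𝔔₁0 : 𝔔₁.comap (algebraMap (𝒮 0) S) = 𝔔.comap (algebraMap (𝒮 0) S) := by
    rw [← h𝔓, h𝔔₁, Ideal.comap_comap]; rfl
  have hun : ∀ n : ℕ, u ^ n ∉ 𝔔 := fun n h => huQ ((inferInstance : 𝔔.IsPrime).mem_of_pow_mem n h)
  have huQ₁ : u ∉ 𝔔₁ := by
    intro h
    have hpow : u ^ addOrderOf b ∈ 𝒮 0 := DiagonalizableQuotient.pow_addOrderOf_mem_gradeZero 𝒮 hu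
    have h1 : (⟨u ^ addOrderOf b, hpow⟩ : 𝒮 0) ∈ 𝔔₁.comap (algebraMap (𝒮 0) S) := by
      rw [Ideal.mem_comap]; exact 𝔔₁.pow_mem_of_mem h _ (hA b).addOrderOf_pos
    rw [h𝔔₁0, Ideal.mem_comap] at h1
    exact hun _ h1
  -- `θ u = χ b • u ∉ 𝔓 ∩ S`
  show (θ.restrictScalars ℤ) u ∉ 𝔔₁
  rw [Derivation.restrictScalars_apply, hθ b u hu]
  intro h
  obtain ⟨c, hc⟩ := hχ.exists_left_inv
  have : u ∈ 𝔔₁ := by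
    have h2 := 𝔔₁.mul_mem_left (algebraMap k S c) h
    rw [Algebra.smul_def, ← mul_assoc, ← map_mul, hc, map_one, one_mul] at h2
    exact h2
  exact huQ₁ this

end Summit.ResolutionOfSingularities.ResolutionOfSingularities.Theorems.FRationalResolution.RootAdjoinRegularOfDerivation

end
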